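import Literature.NumberTheory.EllipticCurves.ComplexMultiplicationBurungaleFlachKatoProofs
import Literature.NumberTheory.EllipticCurves.ComplexMultiplicationShaThreeLeavesProofs
import Literature.NumberTheory.EllipticCurves.ComplexMultiplicationShaHeckeProofs
import Literature.NumberTheory.EllipticCurves.ComplexMultiplicationShaRubinConverseProofs
import HarnessLib

/-!
# bsd.S28 (Rubin): Theorem A (a) for `E_K` below Gross–Zagier–Kolyvagin (bsd.S17)

Sibling *proofs* file (theorems only: no definition, no named fact, no instance) for the named
fact `Literature.NumberTheory.EllipticCurves.Rubin1987_shaFinite_baseChange_cmField`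
(`ComplexMultiplicationShaProofs.lean`), the instance of **Rubin 1987, Theorem A (a)** (K. Rubin,
*Tate–Shafarevich groups and L-functions of elliptic curves with complex multiplication*,
Invent. Math. 89 (1987), Thm. A, p. 527: *"Let `E` be an elliptic curve defined over an imaginary
quadratic field `K`, with complex multiplication by `K`. If `L(E/K, 1) ≠ 0` then `Ш` is
finite"*) used by the tree: for `E/ℚ` with `j(E) ∈ maximalCMJInvariants` (CM by `𝓞_K`), `K` its
CM field (`IsCMFieldOfJ K j(E)`) and `E_K = W.baseChange K`,
`L(E_K/K, 1) ≠ 0 ⇒ Ш(E_K/K)` finite.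

## Review outcome (D-0026 split review of `Rubin1987_shaFinite_baseChange_cmField`)

The statement is faithful to the source and is kept unchanged. Its own decomposition along the
printed proof (level 2, `ComplexMultiplicationShaRubinProofs.lean`: Thm. 6.6 and §10 of the
paper, `Rubin1987_sha_torsionBy_eq_bot_cofinite`, `Rubin1987_sha_primary_finite`) leads into a
theory absent from Mathlib (elliptic units, Wiles' explicit reciprocity law, the Euler-system
descent of §§1–10) and is **not** pursued. Instead this file places the fact, sorry-free, below
the single central rank-`≤ 1` leaf of the BSD cone, exactly as its siblings
`BurungaleFlach2024_finite_primary_cmField_of_GrossZagierKolyvagin` (the `p`-primary finiteness)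
and `shaFinite_of_hasCM_of_L_one_ne_zero_of_grossZagierKolyvagin` (the parent, bsd.S28 over `ℚ`)
already are:

* `Rubin1987_shaFinite_baseChange_cmField_of_GrossZagierKolyvagin_of_hecke` (**proved**):
  Theorem A (a) for `E_K` follows from bsd.S17 `rank_eq_analyticRank_of_analyticRank_le_one`
  (Gross–Zagier–Kolyvagin with modularity; Darmon 2004, Thm. 3.22: `ord_{s=1} L(E,s) ≤ 1 ⇒
  rank E(ℚ) = ord_{s=1} L(E,s)` and `Ш(E/ℚ)` finite) together with the Deuring–Hecke continuation
  of `L(E/ℚ, s)` for maximal-order CM curves (`hasEntireLFunction_of_j_mem_maximalCMJInvariants`,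
  Silverman *Advanced Topics* Cor. II.10.5.1 — the continuation Rubin's (0.1) uses);
* `Rubin1987_shaFinite_baseChange_cmField_of_GrossZagierKolyvagin` (**proved**): the same with
  modularity (`WeierstrassCurve.hasEntireLFunction_rat`, BCDT 2001) in place of Deuring–Hecke —
  both inputs then lie inside the trust base of bsd.S17 itself;
* `Rubin1987_sha_torsionBy_eq_bot_cofinite_of_GrossZagierKolyvagin`,
  `Rubin1987_sha_primary_finite_of_GrossZagierKolyvagin` (**proved**, bookkeeping): the two
  level-2 leaves follow as well, so the whole Rubin sub-DAG of bsd.S28 carries no debt of its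
  own beyond bsd.S17 (+ a continuation leaf).

## The argument

Let `E/ℚ` have `j(E) ∈ maximalCMJInvariants`, `K = ℚ(√d_K)` its CM field, and suppose
`L(E_K/K, 1) ≠ 0`.

1. *Back to `ℚ`.* `L(E_K/K, s) = L(E/ℚ, s)²` as Dirichlet series (Deuring, the tree **theorem**
   `Deuring_LFunction_baseChange_cmField_holds`); since `L(E/ℚ, s)` has an entire continuation
   (`hH`), the continuation of `L(E_K/K, s)` is its square
   (`hasEntireLFunction_of_LFunction_eq_mul_self`), so `L(E/ℚ, 1) ≠ 0`. (A continuation leaf is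
   unavoidable here: with the tree's junk value for `entireLFunction`, `L(E_K/K,1) ≠ 0 ⇒ L(E/ℚ,1) ≠ 0`
   is not provable from the formal identity alone; the converse is,
   `entireLFunction_one_ne_zero_of_LFunction_eq_mul_self`.)
2. *The twist.* The quadratic twist `E^{(d_K)}` is `ℚ`-isogenous to `E`
   (`isIsogenous_quadraticTwist_cmFieldDiscr_holds`), so `L(E^{(d_K)}, 1) = L(E, 1) ≠ 0`
   (`entireLFunction_eq_of_isIsogenous'`, Faltings / Knapp 11.67, a theorem of the tree).
3. *bsd.S17 over `ℚ`, twice.* `E(ℚ)`, `Ш(E/ℚ)`, `E^{(d_K)}(ℚ)`, `Ш(E^{(d_K)}/ℚ)` are finite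
   (`finite_point_and_sha_of_rank_eq_analyticRank`; Mordell–Weil is a theorem of the tree).
4. *Every `p`: `Ш(E_K/K)[p^∞]` is finite* — quadratic descent of `p^∞`-Selmer groups
   (`finite_point_and_primaryComponent_sha_baseChange_of_finite`, after T. & V. Dokchitser,
   Ann. of Math. 172 (2010), proof of Lemma 4.14: the comparison map
   `Sel_{p^∞}(E/ℚ) × Sel_{p^∞}(E^{(d)}/ℚ) → Sel_{p^∞}(E_K/K)` has cokernel killed by `8`).
5. *Almost every `p`: `Ш(E_K/K)[p] = 0`* (`sha_baseChange_torsionBy_eq_zero_cofinite_of_finite`):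
   for an odd prime `p ∤ #Ш(E/ℚ) · #Ш(E^{(d)}/ℚ)`, `Sel_{p^∞}(E/ℚ) = Sel_{p^∞}(E^{(d)}/ℚ) = 0`
   (`selmerGroupPInfty_eq_bot_of_not_dvd_card`: in rank `0`, `Sel_{p^∞} ↪ H¹(ℚ, E)` with image
   `Ш[p^∞] = 0`), so every `s ∈ Sel_{p^∞}(E_K/K)` has `8s = 0` and `pᵏs = 0`, i.e. `s = 0`; and
   `Ш(E_K/K)[p^∞]` is the image of `Sel_{p^∞}(E_K/K)` (`map_primaryH1ToH1_selmerGroupPInfty`).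
6. `Ш(E_K/K)` is torsion with finite primary parts, almost all zero, hence finite
   (`WeierstrassCurve.shaFinite_of_primary`, the shape of the first paragraph of Rubin's §10).

Steps 4–6 replace, for these base-changed curves, the Weil-restriction argument
`Ш(E_K/K) ≅ Ш(Res_{K/ℚ} E_K/ℚ)`, `Res_{K/ℚ} E_K ∼ E × E^{(d_K)}` (Milne, Invent. Math. 17 (1972),
§1), which the tree cannot phrase (no abelian surfaces).

## References

* K. Rubin, *Tate–Shafarevich groups and L-functions of elliptic curves with complex
  multiplication*, Invent. Math. 89 (1987), 527–560: Thm. A (p. 527), §0 Remark (3) (p. 528),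
  §10 (p. 549). [Rubin1987Sha] (cite-only, acq-00382; setting restated in K. Rubin, *Elliptic
  curves with complex multiplication and the conjecture of Birch and Swinnerton-Dyer*, in
  *Arithmetic Theory of Elliptic Curves*, LNM 1716 (1999), p. 167 (PDF p. 215), Theorem.)
* H. Darmon, *Rational points on modular elliptic curves*, CBMS 101 (2004), Thm. 3.22
  (= Thm. 1.14) and §3.9. [Darmon2004]
* T. Dokchitser, V. Dokchitser, *On the Birch–Swinnerton-Dyer quotients modulo squares*, Ann. of
  Math. 172 (2010), Lemma 4.14 (proof). [DokchitserDokchitserAnnals2010]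
* R. Greenberg, *Iwasawa theory for elliptic curves*, LNM 1716 (1999), §1 pp. 54–57, §2 p. 63.
  [Greenberg1999LNM]
* J. H. Silverman, *Advanced Topics in the Arithmetic of Elliptic Curves*, GTM 151 (1994),
  Ch. II Thm. 10.5 and Cor. 10.5.1. [SilvermanATAEC1994]
* J. S. Milne, *On the arithmetic of abelian varieties*, Invent. Math. 17 (1972), §1. [Milne1972]
-/

noncomputable section

open scoped Classical

open WeierstrassCurve

namespace Literature.NumberTheory.EllipticCurves

/-! ### Algebra: elements of `p`-power order in a finite group of order prime to `p` -/

/-- In a finite abelian group `A` with `p ∤ #A`, an element killed by a power of `p` is zero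
(its order divides `gcd(pᵏ, #A) = 1`). [folklore] -/
theorem eq_zero_of_pow_nsmul_eq_zero_of_not_dvd_card {A : Type*} [AddCommGroup A] [Finite A]
    {p k : ℕ} (hp : p.Prime) (hpA : ¬ p ∣ Nat.card A) {a : A} (ha : p ^ k • a = 0) : a = 0 := by
  have hcop : Nat.Coprime (p ^ k) (Nat.card A) := (hp.coprime_iff_not_dvd.2 hpA).pow_left k
  have h1 : addOrderOf a ∣ Nat.gcd (p ^ k) (Nat.card A) :=
    Nat.dvd_gcd (addOrderOf_dvd_of_nsmul_eq_zero ha) (addOrderOf_dvd_natCard a)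
  rw [hcop.gcd_eq_one, Nat.dvd_one] at h1
  exact AddMonoid.addOrderOf_eq_one_iff.mp h1

/-- In an abelian group, an element killed by `8` and by a power of an odd prime `p` is zero.
[folklore] -/
theorem eq_zero_of_eight_nsmul_of_pow_nsmul {A : Type*} [AddCommGroup A] {p k : ℕ} (hp : p.Prime)
    (hp2 : p ≠ 2) {a : A} (h8 : 8 • a = 0) (hk : p ^ k • a = 0) : a = 0 := by
  have hcop : Nat.Coprime 8 (p ^ k) := by
    have h := ((Nat.coprime_primes Nat.prime_two hp).2 (Ne.symm hp2)).pow 3 k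
    norm_num at h
    exact h
  have h1 : addOrderOf a ∣ Nat.gcd 8 (p ^ k) :=
    Nat.dvd_gcd (addOrderOf_dvd_of_nsmul_eq_zero h8) (addOrderOf_dvd_of_nsmul_eq_zero hk)
  rw [hcop.gcd_eq_one, Nat.dvd_one] at h1
  exact AddMonoid.addOrderOf_eq_one_iff.mp h1

/-- In an abelian group `G`, an element of a subgroup `S` with `p ∤ #S` that is killed by a power
of `p` is zero (`#S = 0` for infinite `S`, so the hypothesis forces `S` finite). [folklore] -/
theorem eq_zero_of_mem_of_pow_nsmul_eq_zero {G : Type*} [AddCommGroup G] (S : AddSubgroup G)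
    {p k : ℕ} (hp : p.Prime) (hpS : ¬ p ∣ Nat.card S) {z : G} (hz : z ∈ S) (h : p ^ k • z = 0) :
    z = 0 := by
  by_cases hfin : Finite S
  · have h' : p ^ k • (⟨z, hz⟩ : S) = 0 :=
      Subtype.ext (by rw [AddSubmonoidClass.coe_nsmul, ZeroMemClass.coe_zero]; exact h)
    exact congrArg Subtype.val (eq_zero_of_pow_nsmul_eq_zero_of_not_dvd_card hp hpS h')
  · haveI : Infinite S := not_finite_iff_infinite.mp hfin
    exfalso
    apply hpS
    rw [Nat.card_eq_zero_of_infinite]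
    exact dvd_zero p

/-! ### Rank zero over a number field: `Sel_{p^∞}(E/K) = 0` for `p ∤ #Ш(E/K)` -/

/-- **`Sel_{p^∞}(E/K) = 0` when `E(K)` is finite and `p ∤ #Ш(E/K)`** (so `Ш(E/K)` finite of order
prime to `p`). In rank `0` the map `Sel_{p^∞}(E/K) → H¹(K, E)` is injective
(`ker_primaryH1ToH1_eq_bot_of_finite`: its kernel is `E(K) ⊗ ℚ_p/ℤ_p = 0`) with image inside
`Ш(E/K)` (`selmerGroupPInfty_eq_comap_sha`); a Selmer class is killed by a power of `p`
(`exists_pow_nsmul_eq_zero_galH1Primary`), hence so is its image, which is therefore `0`.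
Greenberg, LNM 1716 (1999), §1 p. 54 (`0 → E(F) ⊗ ℚ_p/ℤ_p → Sel_E(F)_p → Ш_E(F)_p → 0`).
[cite: Greenberg1999LNM, §1 p. 54 and §2 p. 63] -/
theorem selmerGroupPInfty_eq_bot_of_not_dvd_card {K : Type} [Field K] [NumberField K]
    (W : WeierstrassCurve K) [W.IsElliptic] (p : ℕ) [Fact p.Prime] [Finite W.toAffine.Point]
    (hpS : ¬ p ∣ Nat.card W.sha) : W.selmerGroupPInfty p = ⊥ := by
  refine eq_bot_iff.mpr fun x hx ↦ ?_
  rw [AddSubgroup.mem_bot]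
  have hx' : x ∈ W.sha.comap (W.primaryH1ToH1 p) := by
    rwa [← W.selmerGroupPInfty_eq_comap_sha p]
  have hmem : W.primaryH1ToH1 p x ∈ W.sha := AddSubgroup.mem_comap.mp hx'
  obtain ⟨k, hk⟩ := exists_pow_nsmul_eq_zero_galH1Primary W p x
  have hk' : p ^ k • W.primaryH1ToH1 p x = 0 :=
    (map_nsmul (W.primaryH1ToH1 p) (p ^ k) x).symm.trans (by rw [hk, map_zero])
  have h0 : W.primaryH1ToH1 p x = 0 :=
    eq_zero_of_mem_of_pow_nsmul_eq_zero W.sha (Fact.out : p.Prime) hpS hmem hk'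
  have hker : x ∈ (W.primaryH1ToH1 p).ker := AddMonoidHom.mem_ker.2 h0
  rwa [W.ker_primaryH1ToH1_eq_bot_of_finite p, AddSubgroup.mem_bot] at hker

/-! ### Quadratic base change: `Ш(E_K/K)[p] = 0` for almost all `p` -/

section Quadratic

variable (W : WeierstrassCurve ℚ) [W.IsElliptic] (K : Type) [Field K] [NumberField K]
  (h2 : Module.finrank ℚ K = 2) {θ : K} {c : ℚ} (hθ : θ ∉ Set.range (algebraMap ℚ K))
  (hc : θ ^ 2 = algebraMap ℚ K c)

include h2 hθ hc in
/-- **`Sel_{p^∞}(E_K/K) = 0` for odd `p ∤ #Ш(E/ℚ)·#Ш(E^{(c)}/ℚ)`**, for `K = ℚ(θ)`, `θ² = c`, when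
`E(ℚ)`, `E^{(c)}(ℚ)` are finite: both `Sel_{p^∞}(E/ℚ)` and `Sel_{p^∞}(E^{(c)}/ℚ)` vanish
(`selmerGroupPInfty_eq_bot_of_not_dvd_card`), the comparison map of the quadratic descent
`Sel_{p^∞}(E/ℚ) × Sel_{p^∞}(E^{(c)}/ℚ) → Sel_{p^∞}(E_K/K)` has cokernel killed by `8`
(`nsmul_mem_range_comparisonMap`), and a `p`-primary element killed by `8` is `0` for `p` odd.
[cite: DokchitserDokchitserAnnals2010, Lemma 4.14 (proof)] -/
theorem selmerGroupPInfty_baseChange_eq_zero_of_not_dvd [Finite W.toAffine.Point]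
    [(W.quadraticTwist c).IsElliptic] [Finite (W.quadraticTwist c).toAffine.Point]
    {p : ℕ} (hp : p.Prime) (hp2 : p ≠ 2)
    (hdvd : ¬ p ∣ Nat.card W.sha * Nat.card (W.quadraticTwist c).sha)
    (s : (W.baseChange K).selmerGroupPInfty p) : s = 0 := by
  haveI : Fact p.Prime := ⟨hp⟩
  have hE : W.selmerGroupPInfty p = ⊥ :=
    selmerGroupPInfty_eq_bot_of_not_dvd_card W p fun h ↦ hdvd (dvd_mul_of_dvd_left h _)
  have hE' : (W.quadraticTwist c).selmerGroupPInfty p = ⊥ :=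
    selmerGroupPInfty_eq_bot_of_not_dvd_card (W.quadraticTwist c) p
      fun h ↦ hdvd (dvd_mul_of_dvd_right h _)
  obtain ⟨x, hx⟩ := nsmul_mem_range_comparisonMap W K h2 hθ hc p s
  have hx1 : (x.1 : W.galH1Primary p) = 0 := AddSubgroup.mem_bot.mp (hE.le x.1.2)
  have hx2 : (x.2 : (W.quadraticTwist c).galH1Primary p) = 0 := AddSubgroup.mem_bot.mp (hE'.le x.2.2)
  have hx0 : x = 0 := Prod.ext (Subtype.ext hx1) (Subtype.ext hx2)
  have h8 : 8 • s = 0 := by rw [← hx, hx0, map_zero]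
  obtain ⟨k, hk⟩ := exists_pow_nsmul_eq_zero_galH1Primary (W.baseChange K) p
    (s : (W.baseChange K).galH1Primary p)
  have hk' : p ^ k • s = 0 := by
    apply Subtype.ext
    rw [AddSubmonoidClass.coe_nsmul, hk, ZeroMemClass.coe_zero]
  exact eq_zero_of_eight_nsmul_of_pow_nsmul hp hp2 h8 hk'

include h2 hθ hc in
/-- **`Ш(E_K/K)[p] = 0` for all primes `p` outside a finite set**, for `K = ℚ(θ)`, `θ² = c`, when
`E(ℚ)`, `Ш(E/ℚ)`, `E^{(c)}(ℚ)`, `Ш(E^{(c)}/ℚ)` are finite: take `S = {2} ∪ {p ∣ #Ш(E/ℚ)·#Ш(E^{(c)}/ℚ)}`;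
for `p ∉ S`, `Sel_{p^∞}(E_K/K) = 0` (`selmerGroupPInfty_baseChange_eq_zero_of_not_dvd`) and
`Ш(E_K/K)[p^∞]` is the image of `Sel_{p^∞}(E_K/K)` in `H¹(K, E)`
(`map_primaryH1ToH1_selmerGroupPInfty`, Kummer theory with the divisibility of `E(K̄)`), so
`Ш(E_K/K)[p] ⊆ Ш(E_K/K)[p^∞] = 0`. This is the "`Ш_𝔭 = 0` for almost all `𝔭`" half of Rubin's
Theorem A for `E_K`, obtained here over `ℚ`. [cite: DokchitserDokchitserAnnals2010, Lemma 4.14 (proof)]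
[cite: Greenberg1999LNM, §1 p. 54 and §2 p. 63] -/
theorem sha_baseChange_torsionBy_eq_zero_cofinite_of_finite [Finite W.toAffine.Point]
    [Finite W.sha] [(W.quadraticTwist c).IsElliptic] [Finite (W.quadraticTwist c).toAffine.Point]
    [Finite (W.quadraticTwist c).sha] :
    ∃ S : Finset ℕ, ∀ p : ℕ, p.Prime → p ∉ S →
      ∀ s : (W.baseChange K).sha, p • s = 0 → s = 0 := by
  refine ⟨insert 2 (Nat.card W.sha * Nat.card (W.quadraticTwist c).sha).primeFactors,
    fun p hp hpS c₀ hpc₀ ↦ ?_⟩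
  haveI : Fact p.Prime := ⟨hp⟩
  haveI : (W.baseChange K).IsElliptic := by rw [baseChange]; infer_instance
  have hp2 : p ≠ 2 := fun h ↦ hpS (by rw [h]; exact Finset.mem_insert_self 2 _)
  have hn0 : Nat.card W.sha * Nat.card (W.quadraticTwist c).sha ≠ 0 :=
    mul_ne_zero Nat.card_pos.ne' Nat.card_pos.ne'
  have hdvd : ¬ p ∣ Nat.card W.sha * Nat.card (W.quadraticTwist c).sha := fun h ↦
    hpS (Finset.mem_insert_of_mem (Nat.mem_primeFactors.2 ⟨hp, h, hn0⟩))
  -- `c₀ ∈ Ш(E_K/K)[p^∞]`, the image of `Sel_{p^∞}(E_K/K) = 0`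
  have hmap := (W.baseChange K).map_primaryH1ToH1_selmerGroupPInfty p
    (W.baseChange K).zsmul_geomPoints_surjective_holds
  have hc₀ : c₀ ∈ AddCommGroup.primaryComponent (W.baseChange K).sha p :=
    (AddCommGroup.mem_primaryComponent).2 ⟨1, by rwa [pow_one]⟩
  have hc₀' : (c₀ : (W.baseChange K).galH1) ∈
      (AddCommGroup.primaryComponent (W.baseChange K).sha p).map (W.baseChange K).sha.subtype :=
    AddSubgroup.mem_map.mpr ⟨c₀, hc₀, rfl⟩
  rw [← hmap] at hc₀'
  obtain ⟨s, hs, hsc⟩ := AddSubgroup.mem_map.mp hc₀'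
  have hs0 : (⟨s, hs⟩ : (W.baseChange K).selmerGroupPInfty p) = 0 :=
    selmerGroupPInfty_baseChange_eq_zero_of_not_dvd W K h2 hθ hc hp hp2 hdvd _
  have hs0' : s = 0 := congrArg Subtype.val hs0
  rw [hs0', map_zero] at hsc
  exact Subtype.ext hsc.symm

end Quadratic

/-! ### bsd.S17 in rank zero -/

/-- **bsd.S17 in analytic rank zero: `L(E, 1) ≠ 0 ⇒ E(ℚ)` and `Ш(E/ℚ)` finite** (Darmon, CBMS
101, Thm. 1.14 (1) / Thm. 3.22), from the tree's named fact
`rank_eq_analyticRank_of_analyticRank_le_one` (`h17`): `L(E, 1) ≠ 0` gives `r_an = 0`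
unconditionally (`analyticRank_eq_zero_of_entireLFunction_one_ne_zero`), so `rank E(ℚ) = 0`,
i.e. `E(ℚ)` finite (Mordell–Weil, `finite_point_of_rank_zero`), and `Ш(E/ℚ)` is finite.
[cite: Darmon2004, Thm. 3.22 (= Thm. 1.14) and §3.9] -/
theorem finite_point_and_sha_of_rank_eq_analyticRank
    (h17 : rank_eq_analyticRank_of_analyticRank_le_one) (W : WeierstrassCurve ℚ) [W.IsElliptic]
    (hL : W.entireLFunction 1 ≠ 0) : Finite W.toAffine.Point ∧ Finite W.sha := by
  have h0 : W.analyticRank = 0 := analyticRank_eq_zero_of_entireLFunction_one_ne_zero W hL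
  obtain ⟨hrank, hsha⟩ := h17 W (h0.trans_le zero_le_one)
  rw [h0] at hrank
  exact ⟨W.finite_point_of_rank_zero hrank, hsha⟩

/-! ### Theorem A (a) for `E_K` below bsd.S17 -/

/-- **Rubin 1987, Theorem A (a) for `E_K`, from Gross–Zagier–Kolyvagin (bsd.S17) and the
Deuring–Hecke continuation.** `Rubin1987_shaFinite_baseChange_cmField` — for `E/ℚ` with
`j(E) ∈ maximalCMJInvariants`, `K` its CM field, `L(E_K/K, 1) ≠ 0 ⇒ Ш(E_K/K)` finite (Rubin,
Invent. Math. 89 (1987), Thm. A, p. 527, the instance used in §0 Remark (3)) — follows from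
`rank_eq_analyticRank_of_analyticRank_le_one` (`hGZK`; Darmon 2004, Thm. 3.22) and
`hasEntireLFunction_of_j_mem_maximalCMJInvariants` (`hH`; Silverman, *Advanced Topics*,
Cor. II.10.5.1): `L(E_K/K, s) = L(E/ℚ, s)²` (Deuring, `Deuring_LFunction_baseChange_cmField_holds`)
gives `L(E/ℚ, 1) ≠ 0` and, along the CM twist isogeny `E ∼ E^{(d_K)}`
(`isIsogenous_quadraticTwist_cmFieldDiscr_holds`), `L(E^{(d_K)}, 1) ≠ 0`; bsd.S17 makes `E(ℚ)`,
`Ш(E/ℚ)`, `E^{(d_K)}(ℚ)`, `Ш(E^{(d_K)}/ℚ)` finite; the quadratic descent of `p^∞`-Selmer groups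
gives `Ш(E_K/K)[p^∞]` finite for every `p`
(`finite_point_and_primaryComponent_sha_baseChange_of_finite`) and `Ш(E_K/K)[p] = 0` for almost
all `p` (`sha_baseChange_torsionBy_eq_zero_cofinite_of_finite`); and `Ш(E_K/K)` is torsion
(`WeierstrassCurve.shaFinite_of_primary`). [cite: Rubin1987Sha, Thm. A (p. 527) and §10 (p. 549)]
[cite: Darmon2004, Thm. 3.22] [cite: SilvermanATAEC1994, Ch. II Cor. 10.5.1]
[cite: DokchitserDokchitserAnnals2010, Lemma 4.14 (proof)] -/
theorem Rubin1987_shaFinite_baseChange_cmField_of_GrossZagierKolyvagin_of_hecke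
    (hGZK : rank_eq_analyticRank_of_analyticRank_le_one)
    (hH : hasEntireLFunction_of_j_mem_maximalCMJInvariants) :
    Rubin1987_shaFinite_baseChange_cmField := by
  intro W _ hj K _ _ hK hLK
  -- Step 1: `L(E_K/K, ·) = L(E/ℚ, ·)²` on entire continuations, so `L(E/ℚ, 1) ≠ 0`
  have hsq := (hasEntireLFunction_of_LFunction_eq_mul_self (hH W hj)
    (Deuring_LFunction_baseChange_cmField_holds W hj K hK)).2
  have hL : W.entireLFunction 1 ≠ 0 := fun h0 ↦ hLK (by rw [hsq]; simp [h0])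
  -- Step 2: the CM twist `E^{(d_K)} ∼ E`, so `L(E^{(d_K)}, 1) ≠ 0`
  obtain ⟨θ, hθ, hc⟩ := hK.exists_sqrt hj
  have hd0 : (cmFieldDiscr W.j : ℚ) ≠ 0 := ne_zero_of_sq_eq_of_not_mem_range K hθ hc
  haveI : (W.quadraticTwist (cmFieldDiscr W.j : ℚ)).IsElliptic := W.isElliptic_quadraticTwist hd0
  have hLd : (W.quadraticTwist (cmFieldDiscr W.j : ℚ)).entireLFunction 1 ≠ 0 := by
    rw [← entireLFunction_eq_of_isIsogenous' (isIsogenous_quadraticTwist_cmFieldDiscr_holds W hj)]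
    exact hL
  -- Step 3: bsd.S17 over `ℚ` for `E` and `E^{(d_K)}`
  obtain ⟨hpt, hsha⟩ := finite_point_and_sha_of_rank_eq_analyticRank hGZK W hL
  obtain ⟨hptd, hshad⟩ := finite_point_and_sha_of_rank_eq_analyticRank hGZK _ hLd
  haveI := hpt
  haveI := hsha
  haveI := hptd
  haveI := hshad
  -- Steps 4–6: primary parts finite, almost all zero, `Ш` torsion
  refine (W.baseChange K).shaFinite_of_primary (fun p hp ↦ ?_)
    (sha_baseChange_torsionBy_eq_zero_cofinite_of_finite W K hK.1 hθ hc)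
  haveI : Fact p.Prime := ⟨hp⟩
  obtain ⟨-, hshaK⟩ := finite_point_and_primaryComponent_sha_baseChange_of_finite W K hK.1 hθ hc p
    hpt inferInstance hptd inferInstance
  rw [← coe_primaryComponent]
  exact Set.finite_coe_iff.mp hshaK

/-- **Rubin 1987, Theorem A (a) for `E_K`, from Gross–Zagier–Kolyvagin (bsd.S17) and
modularity.** The same with the continuation of `L(E/ℚ, s)` taken from modularity
(`WeierstrassCurve.hasEntireLFunction_rat`, Breuil–Conrad–Diamond–Taylor 2001, Thm. A), an input
of bsd.S17 itself. [cite: Rubin1987Sha, Thm. A (p. 527)] [cite: Darmon2004, Thm. 3.22]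
[cite: BCDTJAMS2001, Theorem A] -/
theorem Rubin1987_shaFinite_baseChange_cmField_of_GrossZagierKolyvagin
    (hGZK : rank_eq_analyticRank_of_analyticRank_le_one) (hmod : hasEntireLFunction_rat) :
    Rubin1987_shaFinite_baseChange_cmField :=
  Rubin1987_shaFinite_baseChange_cmField_of_GrossZagierKolyvagin_of_hecke hGZK
    (hasEntireLFunction_of_j_mem_maximalCMJInvariants_of_hasEntireLFunction_rat hmod)

/-! ### The level-2 leaves below bsd.S17 (bookkeeping) -/

/-- **Rubin 1987, Thm. 6.6 for `E_K` (`Ш(E_K/K)[p] = 0` for almost all `p`) below bsd.S17**: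
through Theorem A (a) (`Rubin1987_sha_torsionBy_eq_bot_cofinite_of_shaFinite`).
[cite: Rubin1987Sha, Thm. 6.6 (p. 541) and Thm. A (p. 527)] [cite: Darmon2004, Thm. 3.22] -/
theorem Rubin1987_sha_torsionBy_eq_bot_cofinite_of_GrossZagierKolyvagin
    (hGZK : rank_eq_analyticRank_of_analyticRank_le_one) (hmod : hasEntireLFunction_rat) :
    Rubin1987_sha_torsionBy_eq_bot_cofinite :=
  Rubin1987_sha_torsionBy_eq_bot_cofinite_of_shaFinite
    (Rubin1987_shaFinite_baseChange_cmField_of_GrossZagierKolyvagin hGZK hmod)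

/-- **Rubin 1987, §10 for `E_K` (`Ш(E_K/K)[p^∞]` finite for every `p`) below bsd.S17**: a finite
group has finite primary parts. [cite: Rubin1987Sha, §10 (p. 549) and Thm. A (p. 527)]
[cite: Darmon2004, Thm. 3.22] -/
theorem Rubin1987_sha_primary_finite_of_GrossZagierKolyvagin
    (hGZK : rank_eq_analyticRank_of_analyticRank_le_one) (hmod : hasEntireLFunction_rat) :
    Rubin1987_sha_primary_finite := by
  intro W _ hj K _ _ hK hL p _
  haveI : Finite (W.baseChange K).sha :=
    Rubin1987_shaFinite_baseChange_cmField_of_GrossZagierKolyvagin hGZK hmod W hj K hK hL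
  exact Set.toFinite _

end Literature.NumberTheory.EllipticCurves

end
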